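import Summits.HodgeConjecture.HodgeConjecture.Theses.TropicalWeilObstruction
import Summits.HodgeConjecture.HodgeConjecture.Theorems.TropicalWeilObstructionTropicalHodgeBoundWeilPairing
import HarnessLib

/-!
# Crux `TropicalHodgeBound` (route `TropicalWeilObstruction`), line `birth`: registered stub
# `stub_weilPairing_thetaClass` — `Ŵ(θ₄(Q)) = 0` for `QJ = JQ`

Registered skeleton `Cruxes/TropicalHodgeBound/Lines/birth.lean` (crux item stmt-HodgeConjecture-18480).
The skeleton-local `dzCoord`, `weilPairing` (`Ŵ`), `thetaClass` and the stub statement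
`WeilPairingThetaClass` are rendered by file-local `notation3` with the skeleton's bodies verbatim
(display only; nothing is defined), so the theorem carries the REGISTERED signature and is
definitionally the skeleton's statement. Proof: the general-`n` identity
`Ŵ(θ_n(Q)) = det (P Q Pᵀ)` (all-maps Cauchy–Binet twice, `P = [1 | i·1]`) and `P Q Pᵀ = 0` for
`Q = [[A, B], [-B, A]]`, both in `TropicalWeilObstructionTropicalHodgeBoundWeilPairing` /
`…FramePairing`, at `n = 4`.

HONEST STATUS. Linear algebra only (stub 2 of 4, sized S/M by the planner); the load-bearing stub 4
(`stub_rationalHodgeCoordinates`) is untouched. No definition, no named fact, no sorry.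
References: [cite: Zharkov2020TropicalWeil, §2].
-/

set_option linter.dupNamespace false

noncomputable section

open scoped BigOperators
open Matrix
open Literature.AlgebraicGeometry.Tropical

namespace Summit.HodgeConjecture.HodgeConjecture.Theorems.TropicalHodgeBound

/-! ## §0 Display-only notation (the skeleton's local definitions, verbatim bodies) -/

/-- The skeleton's `dzCoord n S`. -/
local notation3 (prettyPrint := false) "dz⟦" n "⟧" S:max =>
  (Matrix.det (Matrix.of fun k a : Fin n =>
    (if (S a : ℕ) = (k : ℕ) then (1 : ℂ) else 0) + (if (S a : ℕ) = (k : ℕ) + n then Complex.I else 0)))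

/-- The skeleton's `weilPairing n C` (the value `Ŵ(C)`). -/
local notation3 (prettyPrint := false) "Ŵ⟦" n "⟧" C:max =>
  (∑ S : Fin n → Fin (2 * n), ∑ S' : Fin n → Fin (2 * n),
    dz⟦n⟧ S * dz⟦n⟧ S' / ((Nat.factorial n : ℂ) ^ 2) * ((C S S' : ℝ) : ℂ))

/-- The skeleton's `thetaClass n Q`. -/
local notation3 (prettyPrint := false) "θ⟦" n "⟧" Q:max =>
  (fun S S' : Fin n → Fin (2 * n) => Matrix.det (Matrix.submatrix Q S S'))

/-- The skeleton's `WeilPairingThetaClass` (stub 2 statement). -/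
local notation3 (prettyPrint := false) "WeilPairingThetaClass" =>
  (∀ Q : Matrix (Fin (2 * 4)) (Fin (2 * 4)) ℝ,
    Q * weilJ 4 = weilJ 4 * Q → Ŵ⟦4⟧ (θ⟦4⟧ Q) = 0)

/-! ## §1 The registered stub 2 (`n = 4`) -/

/-- **Stub 2 (registered): `Ŵ(θ₄(Q)) = 0` for `QJ = JQ`.** [cite: Zharkov2020TropicalWeil, §2] -/
theorem stub_weilPairing_thetaClass : WeilPairingThetaClass :=
  fun Q hJ => weilPairing_thetaClass_eq_zero (by norm_num) Q hJ


end Summit.HodgeConjecture.HodgeConjecture.Theorems.TropicalHodgeBound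

end
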